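import Summits.QuantumFields.YangMills.Theorems.SwapVirialDeficitQuantitativeLaplaceStrongConvexOfHessian
import Mathlib.Analysis.InnerProductSpace.Dual
import Mathlib.Analysis.Calculus.FDeriv.Symmetric
import HarnessLib

/-!
# Route `SwapVirialDeficit` (YangMills): quantitative Laplace method — SECOND-ORDER TAYLOR FLOORS with a DIRECTIONAL third-derivative bound
# (mixed norms: the (T1) sup-box step), and the HESSIAN OPERATOR of a `C²` function on a Euclidean space

Width seat `ym-line-sfw-p2-w2` g58 (cell ym-idea-1, free hands), `--supports stmt-QuantumFields-24197`; the generic half of brick W6 (T1) of the LEAD g97 plan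
(`sfw-p2-g97-memo-24197-steep-window-morse-bott.md`): «Taylor along segments with `|D³_F F̂(x)[u,u,u]| ≤ C·L·‖u‖_∞‖u‖₂²` on the box gives
`F̂ ≥ m + ½(1 − δ)⟨A_F(P̃)u,u⟩`».  The third-derivative bound is DIRECTIONAL and in MIXED norms — `|D³F(z)[u,u,u]| ≤ M·N(u)·‖u‖²` with an ARBITRARY auxiliary gauge
`N : V → ℝ` (the model takes `N = ‖·‖_∞` of the chart letters, `M = C·L`) — so no per-mode loss occurs: the floor keeps the exact Euclidean form `‖u‖²` resp. the exact
Hessian form `D²F(x₀)[u,u]`, and the box enters only through `N(u) ≤ ρ_N`.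

* §1 ★ `taylor_two_segment` — Lagrange form of order two along a segment: `F x = F x₀ + DF(x₀)v + ½D²F(x₀)[v,v] + ⅙D³F(x₀ + ξv)[v,v,v]`, `ξ ∈ [0,1]`, `v = x − x₀` (`F ∈ C³`).
* §2 ★★ `taylor_floor_of_third_directional` ∕ `taylor_ceiling_of_third_directional` — on a convex `s` with `|D³F(z)[u,u,u]| ≤ M·N(u)·‖u‖²`:
  `F x₀ + DF(x₀)v + ½D²F(x₀)[v,v] − (M∕6)N(v)‖v‖² ≤ F x ≤ F x₀ + DF(x₀)v + ½D²F(x₀)[v,v] + (M∕6)N(v)‖v‖²`.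
* §3 ★★ `quadratic_floor_of_third_directional` — with a Hessian floor `λ‖u‖² ≤ D²F(x₀)[u,u]`: `F x₀ + DF(x₀)v + ½(λ − M·N(v)∕3)‖v‖² ≤ F x`;
  ★★★ `form_floor_of_third_directional` — (T1) by name: at a CRITICAL point `x₀` (`DF(x₀) = 0`), `λ > 0`, in the box `N(x − x₀) ≤ ρ_N`:
  `F x₀ + ½(1 − M ρ_N∕(3λ))·D²F(x₀)[x − x₀, x − x₀] ≤ F x` — the `hfloor` of ✓`setIntegral_exp_neg_mul_le_gaussian_of_floor` with `δ = Mρ_N∕(3λ)`.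
* §4 ★★ `exists_hessianOperator` — on a finite-dimensional real inner-product space, for `F ∈ C²` at `x₀` there is a SYMMETRIC `A : V →ₗ[ℝ] V` with
  `⟪A y, w⟫ = D²F(x₀)[y,w]` and `⟪A y, y⟫ = D²F(x₀)[y,y]` (Fréchet–Riesz + symmetry of second derivatives) — the dictionary between the `iteratedFDeriv` letters of
  ✓`StrongConvexOfHessian` ∕ ✓`HessianLipschitz` ∕ ✓`FibrePackage` and the operator letters `A p` of ✓`laplaceMethod_quantitative_fibred[_cubic]` ∕ ✓`GaussianCeiling`;
  `hessianOperator_coercive` transfers the floor.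

HONEST FRAMING: generic calculus; no model object (twistTrace, Haar, SU(2), jets) appears; ⟨24197⟩ `SwapGluedStiffness`, ⟨24196⟩, ⟨22884⟩ stay OPEN; no stub ∕ crux ∕ rung ∕
summit is closed; the Yang–Mills mass gap is NOT proved; no summit is proved by a line.  0 definitions, 0 `sorry`, standard axioms.
References: [cite: HasenpflugRudolfSprungk2024, §3.1] (fibred Laplace setting), [folklore] (Taylor–Lagrange, Fréchet–Riesz).
-/

set_option linter.style.longLine false
set_option linter.style.longFile 0
set_option linter.unusedSectionVars false

noncomputable section

open _root_.Set _root_.Metric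
open scoped _root_.InnerProductSpace
open Literature.Analysis.Asymptotics.GaussianBeam (iteratedDeriv_comp_smul)

namespace Summit.QuantumFields.YangMills.Theorems.QuantitativeLaplace

variable {V : Type*} [NormedAddCommGroup V] [InnerProductSpace ℝ V]

/-! ### §1 Order-two Taylor–Lagrange along a segment -/

/-- ★ **Order-two Taylor–Lagrange along the segment `[x₀, x]`** for `F ∈ C³(V)`: there is `ξ ∈ [0,1]` with
`F x = F x₀ + DF(x₀)[v] + ½D²F(x₀)[v,v] + ⅙D³F(x₀ + ξv)[v,v,v]`, `v = x − x₀`. [folklore] -/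
theorem taylor_two_segment {F : V → ℝ} (hF : ContDiff ℝ 3 F) (x₀ x : V) :
    ∃ ξ ∈ Icc (0 : ℝ) 1, F x = F x₀ + fderiv ℝ F x₀ (x - x₀) + (1 / 2) * iteratedFDeriv ℝ 2 F x₀ (fun _ => x - x₀) +
      (1 / 6) * iteratedFDeriv ℝ 3 F (x₀ + ξ • (x - x₀)) (fun _ => x - x₀) := by
  set v : V := x - x₀ with hv
  set G : V → ℝ := fun z => F (z + x₀) with hG
  have hGdiff : ContDiff ℝ 3 G := hF.comp (contDiff_id.add contDiff_const)
  set g : ℝ → ℝ := fun t => G (t • v) with hg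
  have hg_eq : ∀ t, g t = F (x₀ + t • v) := fun t => by simp only [hg, hG, add_comm]
  have hgdiff : ContDiff ℝ 3 g := by
    simp only [hg]; exact hGdiff.comp (contDiff_id.smul contDiff_const)
  have hgder : ∀ n ≤ 3, ∀ t, iteratedDeriv n g t = iteratedFDeriv ℝ n F (x₀ + t • v) fun _ => v := by
    intro n hn t
    have h1 : iteratedDeriv n g t = iteratedFDeriv ℝ n G (t • v) fun _ => v :=
      iteratedDeriv_comp_smul hGdiff v (by exact_mod_cast hn) t
    rw [h1, hG, iteratedFDeriv_comp_add_right, add_comm]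
  have h01 : (0 : ℝ) ≠ 1 := zero_ne_one
  have hIcc : uIcc (0 : ℝ) 1 = Icc 0 1 := uIcc_of_le zero_le_one
  have hIoo : uIoo (0 : ℝ) 1 = Ioo 0 1 := uIoo_of_le zero_le_one
  have hwithin : ∀ n ≤ 3, ∀ t ∈ Icc (0 : ℝ) 1, iteratedDerivWithin n g (Icc 0 1) t = iteratedDeriv n g t :=
    fun n hn t ht => iteratedDerivWithin_eq_iteratedDeriv (uniqueDiffOn_Icc zero_lt_one)
      (hgdiff.contDiffAt.of_le (by exact_mod_cast hn)) ht
  have hf : ContDiffOn ℝ 2 g (uIcc (0 : ℝ) 1) := (hgdiff.of_le (by norm_num)).contDiffOn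
  have hf' : DifferentiableOn ℝ (iteratedDerivWithin 2 g (uIcc (0 : ℝ) 1)) (uIoo (0 : ℝ) 1) := by
    rw [hIcc, hIoo]
    have hd : Differentiable ℝ (iteratedDeriv 2 g) :=
      hgdiff.differentiable_iteratedDeriv 2 (by exact_mod_cast (show (2 : ℕ) < 3 by norm_num))
    refine (hd.differentiableOn (s := Ioo (0 : ℝ) 1)).congr fun t ht => ?_
    exact hwithin 2 (by norm_num) t (Ioo_subset_Icc_self ht)
  obtain ⟨ξ, hξ, hlag⟩ := taylor_mean_remainder_lagrange (f := g) (n := 2) h01 hf hf'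
  rw [hIoo] at hξ
  rw [hIcc] at hlag
  have hξI : ξ ∈ Icc (0 : ℝ) 1 := Ioo_subset_Icc_self hξ
  have h0I : (0 : ℝ) ∈ Icc (0 : ℝ) 1 := left_mem_Icc.mpr zero_le_one
  have hpoly : taylorWithinEval g 2 (Icc 0 1) 0 1 =
      F x₀ + fderiv ℝ F x₀ v + (1 / 2) * iteratedFDeriv ℝ 2 F x₀ (fun _ => v) := by
    rw [taylor_within_apply]
    simp only [Finset.sum_range_succ, Finset.sum_range_zero, zero_add, sub_zero, smul_eq_mul, one_pow,
      Nat.factorial_zero, Nat.factorial_one, Nat.factorial_two, Nat.cast_one, Nat.cast_ofNat, inv_one, one_mul, mul_one]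
    rw [iteratedDerivWithin_zero, hwithin 1 (by norm_num) 0 h0I, hgder 1 (by norm_num) 0, iteratedFDeriv_one_apply,
      hwithin 2 (by norm_num) 0 h0I, hgder 2 (by norm_num) 0]
    simp only [hg, hG, zero_smul, zero_add, add_zero]
    ring
  have h3 : iteratedDerivWithin 3 g (Icc 0 1) ξ = iteratedFDeriv ℝ 3 F (x₀ + ξ • v) fun _ => v := by
    rw [hwithin 3 le_rfl ξ hξI, hgder 3 le_rfl ξ]
  have hg1 : g 1 = F x := by rw [hg_eq]; simp [hv]
  rw [hpoly, h3, hg1] at hlag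
  refine ⟨ξ, hξI, ?_⟩
  have hval : F x - (F x₀ + fderiv ℝ F x₀ v + (1 / 2) * iteratedFDeriv ℝ 2 F x₀ (fun _ => v)) =
      (1 / 6) * iteratedFDeriv ℝ 3 F (x₀ + ξ • v) (fun _ => v) := by
    rw [hlag]; norm_num [Nat.factorial]; ring
  linarith

/-! ### §2 Floors and ceilings from a directional third-derivative bound -/

/-- ★★ **Second-order TAYLOR FLOOR with a DIRECTIONAL `D³` bound in an auxiliary gauge `N`.**  On a convex `s` with `|D³F(z)[u,u,u]| ≤ M·N(u)·‖u‖²` (all `z ∈ s`, all `u`):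
for `x₀, x ∈ s`, `F x₀ + DF(x₀)v + ½D²F(x₀)[v,v] − (M∕6)N(v)‖v‖² ≤ F x`, `v = x − x₀`. [folklore] -/
theorem taylor_floor_of_third_directional {F : V → ℝ} (hF : ContDiff ℝ 3 F) {s : Set V} (hs : Convex ℝ s) {N : V → ℝ} {M : ℝ}
    (hM : ∀ z ∈ s, ∀ u : V, |iteratedFDeriv ℝ 3 F z (fun _ => u)| ≤ M * N u * ‖u‖ ^ 2) {x₀ x : V} (hx₀ : x₀ ∈ s) (hx : x ∈ s) :
    F x₀ + fderiv ℝ F x₀ (x - x₀) + (1 / 2) * iteratedFDeriv ℝ 2 F x₀ (fun _ => x - x₀) - M / 6 * N (x - x₀) * ‖x - x₀‖ ^ 2 ≤ F x := by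
  obtain ⟨ξ, hξ, hT⟩ := taylor_two_segment hF x₀ x
  have hmem : x₀ + ξ • (x - x₀) ∈ s := hs.add_smul_sub_mem hx₀ hx hξ
  have h := (abs_le.1 (hM _ hmem (x - x₀))).1
  rw [hT]; nlinarith

/-- ★ **Second-order TAYLOR CEILING with a directional `D³` bound**: `F x ≤ F x₀ + DF(x₀)v + ½D²F(x₀)[v,v] + (M∕6)N(v)‖v‖²`. [folklore] -/
theorem taylor_ceiling_of_third_directional {F : V → ℝ} (hF : ContDiff ℝ 3 F) {s : Set V} (hs : Convex ℝ s) {N : V → ℝ} {M : ℝ}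
    (hM : ∀ z ∈ s, ∀ u : V, |iteratedFDeriv ℝ 3 F z (fun _ => u)| ≤ M * N u * ‖u‖ ^ 2) {x₀ x : V} (hx₀ : x₀ ∈ s) (hx : x ∈ s) :
    F x ≤ F x₀ + fderiv ℝ F x₀ (x - x₀) + (1 / 2) * iteratedFDeriv ℝ 2 F x₀ (fun _ => x - x₀) + M / 6 * N (x - x₀) * ‖x - x₀‖ ^ 2 := by
  obtain ⟨ξ, hξ, hT⟩ := taylor_two_segment hF x₀ x
  have hmem : x₀ + ξ • (x - x₀) ∈ s := hs.add_smul_sub_mem hx₀ hx hξ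
  have h := (abs_le.1 (hM _ hmem (x - x₀))).2
  rw [hT]; nlinarith

/-! ### §3 Quadratic floors: Euclidean and Hessian-form versions (the (T1) step) -/

/-- ★★ **QUADRATIC FLOOR (Euclidean form)**: Hessian floor `λ‖u‖² ≤ D²F(x₀)[u,u]` at `x₀` and the directional `D³` bound on a convex `s ∋ x₀, x` give
`F x₀ + DF(x₀)v + ½(λ − M·N(v)∕3)‖v‖² ≤ F x`, `v = x − x₀` — no loss in the Euclidean form, the gauge `N` enters linearly. [folklore] -/
theorem quadratic_floor_of_third_directional {F : V → ℝ} (hF : ContDiff ℝ 3 F) {s : Set V} (hs : Convex ℝ s) {N : V → ℝ} {M : ℝ}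
    (hM : ∀ z ∈ s, ∀ u : V, |iteratedFDeriv ℝ 3 F z (fun _ => u)| ≤ M * N u * ‖u‖ ^ 2) {x₀ x : V} (hx₀ : x₀ ∈ s) (hx : x ∈ s)
    {lam : ℝ} (hlam : ∀ u : V, lam * ‖u‖ ^ 2 ≤ iteratedFDeriv ℝ 2 F x₀ (fun _ => u)) :
    F x₀ + fderiv ℝ F x₀ (x - x₀) + (1 / 2) * (lam - M * N (x - x₀) / 3) * ‖x - x₀‖ ^ 2 ≤ F x := by
  have h := taylor_floor_of_third_directional hF hs hM hx₀ hx
  have h2 := hlam (x - x₀)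
  nlinarith

/-- ★★★ **(T1): HESSIAN-FORM FLOOR AT A CRITICAL POINT IN A BOX.**  `F ∈ C³`, convex `s`, `|D³F(z)[u,u,u]| ≤ M·N(u)·‖u‖²` on `s`, `DF(x₀) = 0`, a Hessian floor
`λ‖u‖² ≤ D²F(x₀)[u,u]` with `λ > 0`, and `x ∈ s` in the box `N(x − x₀) ≤ ρ_N` (`0 ≤ M`, `0 ≤ ρ_N`).  Then
`F x₀ + ½(1 − Mρ_N∕(3λ))·D²F(x₀)[x − x₀, x − x₀] ≤ F x` — the hypothesis `hfloor` of ✓`setIntegral_exp_neg_mul_le_gaussian_of_floor` with `δ = Mρ_N∕(3λ)` (take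
`ρ_N = 3λ∕(2mM)` for `δ = 1∕(2m)`: the `(1 − 1/(2m))`-sharp form of the LEAD plan). [folklore] -/
theorem form_floor_of_third_directional {F : V → ℝ} (hF : ContDiff ℝ 3 F) {s : Set V} (hs : Convex ℝ s) {N : V → ℝ} {M : ℝ} (hM0 : 0 ≤ M)
    (hM : ∀ z ∈ s, ∀ u : V, |iteratedFDeriv ℝ 3 F z (fun _ => u)| ≤ M * N u * ‖u‖ ^ 2) {x₀ x : V} (hx₀ : x₀ ∈ s) (hx : x ∈ s)
    (hcrit : fderiv ℝ F x₀ = 0) {lam : ℝ} (hlam0 : 0 < lam) (hlam : ∀ u : V, lam * ‖u‖ ^ 2 ≤ iteratedFDeriv ℝ 2 F x₀ (fun _ => u))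
    {ρN : ℝ} (hρN : 0 ≤ ρN) (hbox : N (x - x₀) ≤ ρN) :
    F x₀ + (1 / 2) * (1 - M * ρN / (3 * lam)) * iteratedFDeriv ℝ 2 F x₀ (fun _ => x - x₀) ≤ F x := by
  have h := taylor_floor_of_third_directional hF hs hM hx₀ hx
  rw [hcrit, _root_.zero_apply, add_zero] at h
  set Q : ℝ := iteratedFDeriv ℝ 2 F x₀ (fun _ => x - x₀) with hQ
  have hQ0 : lam * ‖x - x₀‖ ^ 2 ≤ Q := hlam (x - x₀)
  have hn2 : 0 ≤ ‖x - x₀‖ ^ 2 := sq_nonneg _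
  -- `(M/6) N(v) ‖v‖² ≤ (M ρ_N/6) ‖v‖² ≤ (M ρ_N/(6λ)) Q`
  have h1 : M / 6 * N (x - x₀) * ‖x - x₀‖ ^ 2 ≤ M * ρN / 6 * ‖x - x₀‖ ^ 2 := by
    have : M * N (x - x₀) ≤ M * ρN := mul_le_mul_of_nonneg_left hbox hM0
    nlinarith
  have h2 : M * ρN / 6 * ‖x - x₀‖ ^ 2 ≤ M * ρN / (6 * lam) * Q := by
    have hρ : 0 ≤ M * ρN := mul_nonneg hM0 hρN
    have h3 : M * ρN * (lam * ‖x - x₀‖ ^ 2) ≤ M * ρN * Q := mul_le_mul_of_nonneg_left hQ0 hρ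
    have hl : lam ≠ 0 := hlam0.ne'
    have e1 : M * ρN / 6 * ‖x - x₀‖ ^ 2 = M * ρN * (lam * ‖x - x₀‖ ^ 2) / (6 * lam) := by
      field_simp
    have e2 : M * ρN / (6 * lam) * Q = M * ρN * Q / (6 * lam) := by ring
    rw [e1, e2]
    exact div_le_div_of_nonneg_right h3 (by positivity)
  have e : F x₀ + (1 / 2) * (1 - M * ρN / (3 * lam)) * Q = F x₀ + (1 / 2) * Q - M * ρN / (6 * lam) * Q := by
    field_simp; ring
  rw [e]
  linarith

/-! ### §4 The Hessian operator -/

section Operator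

variable [FiniteDimensional ℝ V]

/-- ★★ **THE HESSIAN OPERATOR.**  For `F : V → ℝ` of class `C²` at `x₀` on a finite-dimensional real inner-product space there is a SYMMETRIC linear operator
`A : V →ₗ[ℝ] V` with `⟪A y, w⟫ = D(DF)(x₀)[y][w]` for all `y, w`, hence `⟪A y, y⟫ = D²F(x₀)[y,y]` (Fréchet–Riesz applied to `w ↦ D(DF)(x₀)[y][w]`; symmetry of second
derivatives). [folklore] -/
theorem exists_hessianOperator {F : V → ℝ} {x₀ : V} {n : WithTop ℕ∞} (hF : ContDiffAt ℝ n F x₀) (hn : 2 ≤ n) :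
    ∃ A : V →ₗ[ℝ] V, A.IsSymmetric ∧ (∀ y w : V, ⟪A y, w⟫_ℝ = fderiv ℝ (fderiv ℝ F) x₀ y w) ∧
      ∀ y : V, ⟪A y, y⟫_ℝ = iteratedFDeriv ℝ 2 F x₀ (fun _ => y) := by
  haveI : CompleteSpace V := FiniteDimensional.complete ℝ V
  set B : V →L[ℝ] V →L[ℝ] ℝ := fderiv ℝ (fderiv ℝ F) x₀ with hB
  -- the operator `y ↦ (toDual)⁻¹ (B y)`
  set A : V →ₗ[ℝ] V :=
    { toFun := fun y => (InnerProductSpace.toDual ℝ V).symm (B y)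
      map_add' := fun y y' => by simp only [map_add]
      map_smul' := fun c y => by
        simp only [map_smul, RingHom.id_apply] } with hA
  have hAyw : ∀ y w : V, ⟪A y, w⟫_ℝ = B y w := fun y w => by
    simp only [hA, LinearMap.coe_mk, AddHom.coe_mk, InnerProductSpace.toDual_symm_apply]
  have hsymm : IsSymmSndFDerivAt ℝ F x₀ := hF.isSymmSndFDerivAt (by simpa using hn)
  refine ⟨A, fun y w => ?_, hAyw, fun y => ?_⟩
  · rw [hAyw, real_inner_comm, hAyw, hB]
    exact hsymm y w
  · rw [hAyw, hB, iteratedFDeriv_two_apply]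

/-- ★ **Coercivity and measurability transfer to the Hessian operator**: a floor `λ‖y‖² ≤ D²F(x₀)[y,y]` is the floor `λ‖y‖² ≤ ⟪A y, y⟫` of the operator of
✓`exists_hessianOperator` (the `hcoer` of ✓`laplaceMethod_quantitative_fibred[_cubic]` ∕ ✓`setIntegral_exp_neg_mul_le_gaussian_of_floor`). [folklore] -/
theorem hessianOperator_coercive {F : V → ℝ} {x₀ : V} {A : V →ₗ[ℝ] V} (hA : ∀ y : V, ⟪A y, y⟫_ℝ = iteratedFDeriv ℝ 2 F x₀ (fun _ => y))
    {lam : ℝ} (hlam : ∀ y : V, lam * ‖y‖ ^ 2 ≤ iteratedFDeriv ℝ 2 F x₀ (fun _ => y)) :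
    ∀ y : V, lam * ‖y‖ ^ 2 ≤ ⟪A y, y⟫_ℝ := fun y => by
  rw [hA]; exact hlam y

end Operator

end Summit.QuantumFields.YangMills.Theorems.QuantitativeLaplace

end
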